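import Summits.SmoothPoincare4.SmoothPoincare4.Theorems.ConvexBisectionAcyclicBisectionExistsChartRegularity
import Summits.SmoothPoincare4.SmoothPoincare4.Theorems.ConvexBisectionAcyclicBisectionExistsCrossingNumberPassages
import Summits.SmoothPoincare4.SmoothPoincare4.Theorems.ConvexBisectionAcyclicBisectionExistsPageTwistingTransverse
import Literature.Topology.FourManifolds.RegularDomainMaps
import Literature.Topology.FourManifolds.LefschetzBaseArcs
import Literature.Topology.FourManifolds.LefschetzBaseCover
import HarnessLib

/-!
# The cyclic symmetry `(x, y) ↦ (e^{2πik/(2g+1)} x, y)` of the Lefschetz base and of annulus charts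
(wave 4, brick Y4-1 of the model chain (R2) `exists_charted_chain` for the missing lemma
`crossingNumber_eq_stdSymp` of node N1a of stub `stub_modelsOnFibred_of_reach` = NF4, line
`modp-braid-orbits`, crux `ConvexBisection.AcyclicBisectionExists`, item stmt-SmoothPoincare4-10508;
registered sub-goal `helper_chart_baseRot`)

The base `Base g = {‖y² − x^{2g+1} − 1‖² + eta ‖x‖² ≤ 1/4} ⊂ ℂ²` and all its pages
`page g c = {‖x‖² < 4, w = c/2}` are invariant under the unitary, complex-linear map
`μ_k (x, y) = (ω^k x, y)`, `ω = e^{2πi/(2g+1)}` (`rootU`), since `(ω^k x)^{2g+1} = x^{2g+1}`: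

* §1 the ambient map `rotAmbL g k : ℝ⁴ →L[ℝ] ℝ⁴` and its restriction **`baseRot g k : Base g →
  Base g`** (`w`, `rho`, `‖x‖`, pages preserved; injective; `baseRot j ∘ baseRot k =
  baseRot (j + k)`, period `2g+1`); it carries the chord lifts of the `A_{2g}` chain to each other
  ON THE NOSE: `rotAmbL g k (chordLift g i ε s) = chordLift g (i + k) ε s` (`ω^k ζ_i = ζ_{i+k}`);
* §2 **annulus charts are transported**: if `(a, φ)` satisfies the six chart hypotheses of node
  N1a (smooth, `1`-periodic, core `a`, in `page g c`, injective on `[0,1) × (−1,1)`, positively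
  oriented `0 < ⟪∂ᵣφ, i ∂ᵤφ⟫`) then so does `(baseRot g k ∘ a, baseRot g k ∘ φ)`
  (`helper_chart_baseRot`; smoothness through the regular domain `contMDiff_codRestrict`,
  orientation because `rotAmbL` is unitary and commutes with `i`);
* §3 crossing numbers are transported: `crossingNumber (baseRot k ∘ φ) (baseRot (k + j) ∘ K) =
  crossingNumber φ (baseRot j ∘ K)` (`crossingNumber_comp_of_injective`).

Everything is proved; no `sorry`.  References: J. Milnor, *Singular points of complex
hypersurfaces* (1968), §9 [Milnor1968]; B. Farb, D. Margalit, *A primer on mapping class groups*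
(2012), §6.1 [FarbMargalit2012].
-/

noncomputable section

set_option linter.dupNamespace false

open scoped Manifold ContDiff Topology ComplexConjugate Real
open Set Function Metric Complex
open Literature.Topology.FourManifolds Literature.Topology.FourManifolds.LefschetzBase
  Literature.Topology.FourManifolds.TorusKnotMilnor

namespace Summit.SmoothPoincare4.SmoothPoincare4.Theorems.AcyclicBisectionExists.ModpBraidOrbits

variable {g : ℕ}

/-! ## §1 The ambient rotation and its restriction to the base -/

/-- `mk` is additive. [folklore] -/
theorem mk_add_mk (a b a' b' : ℂ) : mk a b + mk a' b' = mk (a + a') (b + b') :=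
  ext_cx_cy (by simp [cx_add]) (by simp [cy_add])

/-- `mk` commutes with real scalars. [folklore] -/
theorem smul_mk (t : ℝ) (a b : ℂ) : t • mk a b = mk (t * a) (t * b) :=
  ext_cx_cy (by simp [cx_smul]) (by simp [cy_smul])

/-- **The ambient rotation** `(x, y) ↦ (ω^k x, y)`, `ω = e^{2πi/(2g+1)}`, as a real continuous
linear map of `ℝ⁴ = ℂ²`. [folklore] -/
def rotAmbL (g k : ℕ) : EuclideanSpace ℝ (Fin 4) →L[ℝ] EuclideanSpace ℝ (Fin 4) :=
  LinearMap.toContinuousLinearMap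
    { toFun := fun p => mk (rootU (2 * g + 1) ^ k * cx p) (cy p)
      map_add' := fun p q => by rw [mk_add_mk, cx_add, cy_add, mul_add]
      map_smul' := fun t p => by
        rw [RingHom.id_apply, smul_mk, cx_smul, cy_smul]; ring_nf }

/-- The formula of the ambient rotation. [folklore] -/
theorem rotAmbL_apply (g k : ℕ) (p : EuclideanSpace ℝ (Fin 4)) :
    rotAmbL g k p = mk (rootU (2 * g + 1) ^ k * cx p) (cy p) := rfl

/-- `x`-coordinate of the rotation. [folklore] -/
@[simp] theorem cx_rotAmbL (g k : ℕ) (p : EuclideanSpace ℝ (Fin 4)) :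
    cx (rotAmbL g k p) = rootU (2 * g + 1) ^ k * cx p := by rw [rotAmbL_apply, cx_mk]

/-- `y`-coordinate of the rotation. [folklore] -/
@[simp] theorem cy_rotAmbL (g k : ℕ) (p : EuclideanSpace ℝ (Fin 4)) :
    cy (rotAmbL g k p) = cy p := by rw [rotAmbL_apply, cy_mk]

/-- `‖ω^k‖ = 1`. [folklore] -/
theorem norm_rootU_pow (n k : ℕ) : ‖rootU n ^ k‖ = 1 := by rw [norm_pow, norm_rootU, one_pow]

/-- `ω^k · conj (ω^k) = 1`. [folklore] -/
theorem rootU_pow_mul_conj (n k : ℕ) : rootU n ^ k * conj (rootU n ^ k) = 1 := by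
  rw [Complex.mul_conj, Complex.normSq_eq_norm_sq, norm_rootU_pow]; norm_num

/-- The rotation preserves `w = y² − x^{2g+1} − 1`. [folklore] -/
theorem w_rotAmbL (g k : ℕ) (p : EuclideanSpace ℝ (Fin 4)) : w g (rotAmbL g k p) = w g p := by
  rw [w_eq', w_eq', cx_rotAmbL, cy_rotAmbL, mul_pow, rootU_pow_pow (Nat.succ_ne_zero _), one_mul]

/-- The rotation preserves `‖x‖`. [folklore] -/
theorem norm_cx_rotAmbL (g k : ℕ) (p : EuclideanSpace ℝ (Fin 4)) :
    ‖cx (rotAmbL g k p)‖ = ‖cx p‖ := by rw [cx_rotAmbL, norm_mul, norm_rootU_pow, one_mul]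

/-- The rotation preserves `rho`. [folklore] -/
theorem rho_rotAmbL (g k : ℕ) (p : EuclideanSpace ℝ (Fin 4)) : rho g (rotAmbL g k p) = rho g p := by
  rw [rho, rho, w_rotAmbL, norm_cx_rotAmbL]

/-- Composition of rotations. [folklore] -/
theorem rotAmbL_rotAmbL (g j k : ℕ) (p : EuclideanSpace ℝ (Fin 4)) :
    rotAmbL g j (rotAmbL g k p) = rotAmbL g (j + k) p := by
  rw [rotAmbL_apply, rotAmbL_apply, rotAmbL_apply, cx_mk, cy_mk, pow_add, mul_assoc]

/-- `rotAmbL g 0 = id`. [folklore] -/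
theorem rotAmbL_zero (g : ℕ) (p : EuclideanSpace ℝ (Fin 4)) : rotAmbL g 0 p = p := by
  rw [rotAmbL_apply, pow_zero, one_mul, mk_cx_cy]

/-- The rotation has period `2g+1`. [folklore] -/
theorem rotAmbL_period (g k : ℕ) (p : EuclideanSpace ℝ (Fin 4)) :
    rotAmbL g (k + (2 * g + 1)) p = rotAmbL g k p := by
  rw [rotAmbL_apply, rotAmbL_apply, pow_add, rootU_pow_self (Nat.succ_ne_zero _), mul_one]

/-- The rotation commutes with the complex structure `i`. [folklore] -/
theorem rotAmbL_cplxJ (g k : ℕ) (v : EuclideanSpace ℝ (Fin 4)) :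
    rotAmbL g k (cplxJ v) = cplxJ (rotAmbL g k v) :=
  ext_cx_cy (by simp; ring) (by simp)

/-- **The rotation is unitary for the Kähler pairing**: `⟪μ V, i μ T⟫ = ⟪V, i T⟫`. [folklore] -/
theorem inner_rotAmbL_cplxJ (g k : ℕ) (V T : EuclideanSpace ℝ (Fin 4)) :
    inner ℝ (rotAmbL g k V) (cplxJ (rotAmbL g k T)) = inner ℝ V (cplxJ T) := by
  rw [inner_eq_re_herm, inner_eq_re_herm, cx_cplxJ, cy_cplxJ, cx_cplxJ, cy_cplxJ, cx_rotAmbL,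
    cy_rotAmbL, cx_rotAmbL, cy_rotAmbL]
  have h := rootU_pow_mul_conj (2 * g + 1) k
  congr 1
  simp only [map_mul]
  linear_combination (cx V * (conj I * conj (cx T))) * h

/-- **The rotation maps the `i`-th chord lift to the `(i+k)`-th one on the nose**
(`ω^k ζ_i = ζ_{i+k}` and `(ω^k x)^{2g+1} = x^{2g+1}`). [folklore] -/
theorem rotAmbL_chordLift (g k i : ℕ) (ε : ℂ) (s : ℝ) :
    rotAmbL g k (chordLift g i ε s) = chordLift g (i + k) ε s := by
  have hx : rootU (2 * g + 1) ^ k * chordX g i s = chordX g (i + k) s := by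
    simp only [chordX, branchPt_eq_halfRoot_mul, pow_add]; ring
  rw [rotAmbL_apply, chordLift, chordLift, cx_mk, cy_mk, hx, ← hx, mul_pow,
    rootU_pow_pow (Nat.succ_ne_zero _), one_mul]

/-- **The cyclic symmetry of the base** `baseRot g k : Base g → Base g`, `(x, y) ↦ (ω^k x, y)`.
[cite: Milnor1968, §9] -/
def baseRot (g k : ℕ) (p : Base g) : Base g :=
  ⟨rotAmbL g k p.1, by
    show rho g (rotAmbL g k p.1) ≤ 1 / 4
    rw [rho_rotAmbL]; exact p.2⟩

/-- The ambient point of `baseRot`. [folklore] -/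
@[simp] theorem baseRot_val (g k : ℕ) (p : Base g) : (baseRot g k p).1 = rotAmbL g k p.1 := rfl

/-- `baseRot` is continuous. [folklore] -/
theorem continuous_baseRot (g k : ℕ) : Continuous (baseRot g k) :=
  Continuous.subtype_mk ((rotAmbL g k).continuous.comp continuous_subtype_val) _

/-- `baseRot` is injective. [folklore] -/
theorem baseRot_injective (g k : ℕ) : Injective (baseRot g k) := by
  intro p q h
  have h' := congrArg (fun z : Base g => z.1) h
  simp only [baseRot_val] at h'
  apply Subtype.ext
  refine ext_cx_cy ?_ ?_
  · have := congrArg cx h'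
    rw [cx_rotAmbL, cx_rotAmbL] at this
    exact mul_left_cancel₀ (pow_ne_zero _ (rootU_ne_zero _)) this
  · have := congrArg cy h'
    rwa [cy_rotAmbL, cy_rotAmbL] at this

/-- Composition of the base rotations. [folklore] -/
theorem baseRot_baseRot (g j k : ℕ) (p : Base g) : baseRot g j (baseRot g k p) = baseRot g (j + k) p :=
  Subtype.ext (rotAmbL_rotAmbL g j k p.1)

/-- `baseRot g 0 = id`. [folklore] -/
theorem baseRot_zero (g : ℕ) (p : Base g) : baseRot g 0 p = p := Subtype.ext (rotAmbL_zero g p.1)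

/-- Period `2g+1`. [folklore] -/
theorem baseRot_period (g k : ℕ) (p : Base g) : baseRot g (k + (2 * g + 1)) p = baseRot g k p :=
  Subtype.ext (rotAmbL_period g k p.1)

/-- **Pages are invariant.** [folklore] -/
theorem baseRot_mem_page_iff (g k : ℕ) {c : ℂ} (p : Base g) : baseRot g k p ∈ page g c ↔ p ∈ page g c := by
  simp only [page, mem_setOf_eq, baseRot_val, norm_cx_rotAmbL, w_rotAmbL]

/-! ## §2 Annulus charts are transported by the symmetry -/

variable {c : ℂ} {φ : ℝ × ℝ → Base g} {a : sphere (0 : EuclideanSpace ℝ (Fin 2)) 1 → Base g}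

/-- **Smoothness is transported** (smooth maps into the regular domain `Base g`:
`contMDiff_codRestrict`). [cite: LeeSmoothManifolds2013, Cor. 5.30] -/
theorem contMDiff_baseRot_comp (hφs : ContMDiff 𝓘(ℝ, ℝ × ℝ) (𝓡∂ 4) ∞ φ) (k : ℕ) :
    ContMDiff 𝓘(ℝ, ℝ × ℝ) (𝓡∂ 4) ∞ (baseRot g k ∘ φ) := by
  have hG : ContDiff ℝ ∞ fun p : ℝ × ℝ => rotAmbL g k (φ p).1 :=
    (rotAmbL g k).contDiff.comp (contDiff_val_of_chart hφs)
  have hS : ∀ p : ℝ × ℝ, rotAmbL g k (φ p).1 ∈ rho g ⁻¹' Iic (1 / 4 : ℝ) := fun p => by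
    show rho g (rotAmbL g k (φ p).1) ≤ 1 / 4
    rw [rho_rotAmbL]; exact (φ p).2
  exact (RegularSublevel.halfSliceAtlas (isRegularLevel_rho g)).contMDiff_codRestrict hS hG.contMDiff

/-- Periodicity is transported. [folklore] -/
theorem baseRot_comp_periodic (hφ1 : ∀ u r, φ (u + 1, r) = φ (u, r)) (k : ℕ) (u r : ℝ) :
    (baseRot g k ∘ φ) (u + 1, r) = (baseRot g k ∘ φ) (u, r) := by
  simp only [comp_apply, hφ1]

/-- The core is transported. [folklore] -/
theorem baseRot_comp_core (hφa : ∀ u, φ (u, 0) = a (circlePt u)) (k : ℕ) (u : ℝ) :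
    (baseRot g k ∘ φ) (u, 0) = (baseRot g k ∘ a) (circlePt u) := by
  simp only [comp_apply, hφa]

/-- The page condition is transported. [folklore] -/
theorem baseRot_comp_mem_page (hφp : ∀ p, φ p ∈ page g c) (k : ℕ) (p : ℝ × ℝ) :
    (baseRot g k ∘ φ) p ∈ page g c :=
  (baseRot_mem_page_iff g k (φ p)).2 (hφp p)

/-- Injectivity on the fundamental strip is transported. [folklore] -/
theorem baseRot_comp_injOn (hφi : InjOn φ (Ico (0 : ℝ) 1 ×ˢ Ioo (-1 : ℝ) 1)) (k : ℕ) :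
    InjOn (baseRot g k ∘ φ) (Ico (0 : ℝ) 1 ×ˢ Ioo (-1 : ℝ) 1) :=
  (baseRot_injective g k).comp_injOn hφi

/-- The `u`-derivative of the transported ambient chart map is the rotated `u`-derivative.
[folklore] -/
theorem deriv_baseRot_comp_u (hφs : ContMDiff 𝓘(ℝ, ℝ × ℝ) (𝓡∂ 4) ∞ φ) (k : ℕ) (u r : ℝ) :
    deriv (fun u' => ((baseRot g k ∘ φ) (u', r)).1) u = rotAmbL g k (deriv (fun u' => (φ (u', r)).1) u) := by
  have h := hasDerivAt_val_u hφs u r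
  rw [h.deriv]
  exact ((rotAmbL g k).hasFDerivAt.comp_hasDerivAt u h).deriv

/-- The `r`-derivative of the transported ambient chart map is the rotated `r`-derivative.
[folklore] -/
theorem deriv_baseRot_comp_r (hφs : ContMDiff 𝓘(ℝ, ℝ × ℝ) (𝓡∂ 4) ∞ φ) (k : ℕ) (u r : ℝ) :
    deriv (fun r' => ((baseRot g k ∘ φ) (u, r')).1) r = rotAmbL g k (deriv (fun r' => (φ (u, r')).1) r) := by
  have h := hasDerivAt_val_r hφs u r
  rw [h.deriv]
  exact ((rotAmbL g k).hasFDerivAt.comp_hasDerivAt r h).deriv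

/-- **The orientation is transported** (`rotAmbL` is unitary and complex-linear). [folklore] -/
theorem baseRot_comp_orient (hφs : ContMDiff 𝓘(ℝ, ℝ × ℝ) (𝓡∂ 4) ∞ φ)
    (hφo : ∀ u r, r ∈ Ioo (-1 : ℝ) 1 →
      0 < inner ℝ (deriv (fun r' => (φ (u, r')).1) r) (cplxJ (deriv (fun u' => (φ (u', r)).1) u)))
    (k : ℕ) (u r : ℝ) (hr : r ∈ Ioo (-1 : ℝ) 1) :
    0 < inner ℝ (deriv (fun r' => ((baseRot g k ∘ φ) (u, r')).1) r)
      (cplxJ (deriv (fun u' => ((baseRot g k ∘ φ) (u', r)).1) u)) := by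
  rw [deriv_baseRot_comp_u hφs, deriv_baseRot_comp_r hφs, inner_rotAmbL_cplxJ]
  exact hφo u r hr

/-- **Sub-goal `helper_chart_baseRot`** (Y4-1 of the model chain (R2) for node N1a of NF4): the six
annulus-chart hypotheses of node N1a for `(a, φ)` in `page g c` imply the same six hypotheses for
the rotated pair `(baseRot g k ∘ a, baseRot g k ∘ φ)`. [cite: Milnor1968, §9] -/
theorem helper_chart_baseRot : ∀ (g k : ℕ) (c : ℂ) (a : Metric.sphere (0 : EuclideanSpace ℝ (Fin 2)) 1 → Literature.Topology.FourManifolds.LefschetzBase.Base g) (φ : ℝ × ℝ → Literature.Topology.FourManifolds.LefschetzBase.Base g), ContMDiff 𝓘(ℝ, ℝ × ℝ) (𝓡∂ 4) ∞ φ → (∀ u r, φ (u + 1, r) = φ (u, r)) → (∀ u, φ (u, 0) = a (Literature.Topology.FourManifolds.circlePt u)) → (∀ p, φ p ∈ Literature.Topology.FourManifolds.LefschetzBase.page g c) → Set.InjOn φ (Set.Ico (0 : ℝ) 1 ×ˢ Set.Ioo (-1 : ℝ) 1) → (∀ u r, r ∈ Set.Ioo (-1 : ℝ) 1 → 0 <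 inner ℝ (deriv (fun r' => (φ (u, r')).1) r) (Literature.Topology.FourManifolds.LefschetzBase.cplxJ (deriv (fun u' => (φ (u', r)).1) u))) → ContMDiff 𝓘(ℝ, ℝ × ℝ) (𝓡∂ 4) ∞ (Summit.SmoothPoincare4.SmoothPoincare4.Theorems.AcyclicBisectionExists.ModpBraidOrbits.baseRot g k ∘ φ) ∧ (∀ u r, (Summit.SmoothPoincare4.SmoothPoincare4.Theorems.AcyclicBisectionExists.ModpBraidOrbits.baseRot g k ∘ φ) (u + 1, r) = (Summit.SmoothPoincare4.SmoothPoincare4.Theorems.AcyclicBisectionExists.ModpBraidOrbits.baseRot g k ∘ φ) (u, r)) ∧ (∀ u, (Summit.SmoothPoincare4.SmoothPoincare4.Theorems.AcyclicBisectionExists.ModpBraidOrbits.baseRot g k ∘ φ) (u, 0) = (Summit.SmoothPoincare4.SmoothPoincare4.Theorems.AcyclicBisectionExists.ModpBraidOrbits.baseRot g k ∘ a) (Literature.Topology.FourManifolds.circlePt u)) ∧ (∀ p, (Summit.SmoothPoincare4.SmoothPoincare4.Theorems.AcyclicBisectionExists.ModpBraidOrbits.baseRot g k ∘ φ) p ∈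 Literature.Topology.FourManifolds.LefschetzBase.page g c) ∧ Set.InjOn (Summit.SmoothPoincare4.SmoothPoincare4.Theorems.AcyclicBisectionExists.ModpBraidOrbits.baseRot g k ∘ φ) (Set.Ico (0 : ℝ) 1 ×ˢ Set.Ioo (-1 : ℝ) 1) ∧ (∀ u r, r ∈ Set.Ioo (-1 : ℝ) 1 → 0 < inner ℝ (deriv (fun r' => ((Summit.SmoothPoincare4.SmoothPoincare4.Theorems.AcyclicBisectionExists.ModpBraidOrbits.baseRot g k ∘ φ) (u, r')).1) r) (Literature.Topology.FourManifolds.LefschetzBase.cplxJ (deriv (fun u' => ((Summit.SmoothPoincare4.SmoothPoincare4.Theorems.AcyclicBisectionExists.ModpBraidOrbits.baseRot g k ∘ φ) (u', r)).1) u))) :=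
  fun _ k _ _ _ hφs hφ1 hφa hφp hφi hφo =>
    ⟨contMDiff_baseRot_comp hφs k, baseRot_comp_periodic hφ1 k, baseRot_comp_core hφa k,
      baseRot_comp_mem_page hφp k, baseRot_comp_injOn hφi k, baseRot_comp_orient hφs hφo k⟩

/-! ## §3 Crossing numbers are transported -/

variable {K : sphere (0 : EuclideanSpace ℝ (Fin 2)) 1 → Base g}

/-- **`crossingNumber (μ_k ∘ φ) (μ_k ∘ K) = crossingNumber φ K`.** [cite: FarbMargalit2012, §6.1] -/
theorem crossingNumber_baseRot_comp (hφ1 : ∀ u r, φ (u + 1, r) = φ (u, r))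
    (hφi : InjOn φ (Ico (0 : ℝ) 1 ×ˢ Ioo (-1 : ℝ) 1)) (k : ℕ) :
    crossingNumber (baseRot g k ∘ φ) (baseRot g k ∘ K) = crossingNumber φ K :=
  crossingNumber_comp_of_injective (baseRot_injective g k) hφ1 hφi

/-- **`crossingNumber (μ_k ∘ φ) (μ_{j+k} ∘ K) = crossingNumber φ (μ_j ∘ K)`** — the crossing
numbers of a rotation-generated family depend only on the difference of the indices.
[cite: FarbMargalit2012, §6.1] -/
theorem crossingNumber_baseRot_comp_add (hφ1 : ∀ u r, φ (u + 1, r) = φ (u, r))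
    (hφi : InjOn φ (Ico (0 : ℝ) 1 ×ˢ Ioo (-1 : ℝ) 1)) (j k : ℕ) :
    crossingNumber (baseRot g k ∘ φ) (baseRot g (k + j) ∘ K) = crossingNumber φ (baseRot g j ∘ K) := by
  have e : baseRot g (k + j) ∘ K = baseRot g k ∘ (baseRot g j ∘ K) := by
    funext θ; simp only [comp_apply, baseRot_baseRot]
  rw [e]
  exact crossingNumber_baseRot_comp hφ1 hφi k

/-- Period `2g+1` in the loop index. [folklore] -/
theorem baseRot_comp_period (k : ℕ) : baseRot g (k + (2 * g + 1)) ∘ K = baseRot g k ∘ K := by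
  funext θ; simp only [comp_apply, baseRot_period]

end Summit.SmoothPoincare4.SmoothPoincare4.Theorems.AcyclicBisectionExists.ModpBraidOrbits

end
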